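import Summits.QuantumFields.BalabanUV.T4Continuum.Support.RegionCollarCutoff

/-!
# `BalabanUV.T4Continuum.Support.RegionCollarLift` — NE2 (node U1a) formalisation swarm, SUPPLIER item «Δ1-VEC-W1-HOLED» under the
# owner's sub-row `T4-U1a.S-NE2-D1-DIRICHLET°` (vector layer W1), file 3/4: THE GRADIENT OF THE COLLAR LIFT IS PAID BY THE BLOCK DATA —
# `nsq (∂ (lift g)) ≤ 2·3^d·Σ_ρ Σ_{j : j_ρ+1<n} ‖(∂_ρ g)(bpt w j)‖² + 2d·3^d·Σ_j ‖g (bpt w j)‖²` «not in print; our construction»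
# (unit b2b-balaban-t4-ne2-formalise-leaf-09, gen 9, v1)

HONEST FRAMING (T4-DAG p. 1).  [folklore] the summation half of the collar construction: the torus sum of a function vanishing off the
collar is the chart sum over `(k, j) ∈ {0,1,2}^d × {0,…,n−1}^d` (`sum_collar_eq`, the chart being a bijection onto the collar for
`3 ≤ M_ν`); per sub-block `k` the fold reads the block `w` injectively, so the mass terms give `3^d·Σ_j ‖g(bpt w j)‖²` and the bond terms —
the SAME bond of `w` in an identity direction, the REVERSED bond in a reflected direction (file 1) — give at most `3^d` copies of the
in-block gradient sum of `g`; with file 2's bond-by-bond inequality this is **`nsq_grad_lift_le`**.  Nothing printed is a hypothesis; NE2 (U1a)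
NOT proved; spine PROVED 0/9 unchanged; NOT [B9] (3.23)–(3.27) as printed; NOT infinite volume, NOT the mass gap, NOT Clay.  HONEST
DEPENDENCY (verbatim): «continuum YM on T⁴ ⇐ BetaPertH ∧ nine spine estimates (0/9 proved); BetaPertH ⇐ (D1) ∧ (D4) ∧ CAP+tail; G-an2-4
gates asym, D1 and NE2/3/4.»

ABSOLUTE RULE (cell, verbatim): «No internally-minted statement may enter as a cited fact. Every hypothesis is either kernel-proved in
this package or a verbatim quotation of a PUBLISHED theorem with page reference. The manuscript(s) under audit are NOT citable for
their own disputed steps — they are the thing under adjudication; programme-internal (2001/route/tribunal) claims are never citable.»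
[folklore] throughout; one data def (`predD`); no `def … : Prop`.  NOT CLAIMED: anything about the operator yet; NE2; NE3.
-/

noncomputable section

open scoped BigOperators ComplexConjugate Matrix
open Finset

namespace Summit.QuantumFields.BalabanUV.T4Continuum.RegionCollarLift

open Literature.MathematicalPhysics.QuantumFieldTheory.Balaban1983to89.B5Prop11Plancherel (Tor fine unitVec)
open Literature.MathematicalPhysics.QuantumFieldTheory.Balaban1983to89.B5Prop11Lower (nsq nsq_nonneg)
open Literature.MathematicalPhysics.QuantumFieldTheory.Balaban1983to89.B5Action121 (GradOp GradOp_mulVec sdiff sdiff_mulVec)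
open Literature.MathematicalPhysics.QuantumFieldTheory.Balaban1983to89.B5Block118 (bpt)
open Literature.MathematicalPhysics.QuantumFieldTheory.Balaban1983to89.B5Blocks16 (blockOf blockOf_bpt)
open Summit.QuantumFields.BalabanUV.T4Continuum
open Summit.QuantumFields.BalabanUV.T4Continuum.ScalarBlockTrialFunction (digits digits_bpt bpt_add_unitVec_of_lt)
open Summit.QuantumFields.BalabanUV.T4Continuum.RegionCollarFold
open Summit.QuantumFields.BalabanUV.T4Continuum.RegionCollarCutoff

variable {d : ℕ} (n : ℕ) [NeZero n] (M : Fin d → ℕ) [hM : ∀ μ, NeZero (M μ)] (w : Tor M)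

/-! ## §1 Torus sums over the collar are chart sums -/

/-- **A FUNCTION VANISHING OFF THE COLLAR SUMS OVER THE CHART** (`3 ≤ M_ν`). [folklore] -/
theorem sum_collar_eq (hM3 : ∀ μ, 3 ≤ M μ) (f : Tor (fine n M) → ℝ) (hf : ∀ x, x ∉ collar n M w → f x = 0) :
    ∑ x, f x = ∑ k : Fin d → Fin 3, ∑ j : Fin d → Fin n, f (csite n M w k j) := by
  classical
  have hinj := csite_injective n M w hM3
  rw [← Finset.sum_product' (f := fun k j => f (csite n M w k j)),
    ← Finset.sum_image (f := f) (s := univ ×ˢ univ) (g := fun kj : (Fin d → Fin 3) × (Fin d → Fin n) => csite n M w kj.1 kj.2)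
      (fun a _ b _ h => hinj h)]
  symm
  refine Finset.sum_subset (subset_univ _) fun x _ hx => hf x fun hxc => hx ?_
  exact mem_image.2 ⟨(kfin n M w x hxc, digits n M x), by simp, csite_kfin n M w x hxc⟩

omit [NeZero n] hM in
/-- reading `w` through the fold of one sub-block does not increase a nonnegative site sum. [folklore] -/
theorem sum_foldD_le (k : Fin d → Fin 3) (h : (Fin d → Fin n) → ℝ) (hh : ∀ j, 0 ≤ h j) :
    ∑ j, h (foldD n k j) ≤ ∑ j, h j := by
  classical
  rw [← Finset.sum_image (f := h) (fun a _ b _ hab => foldD_injective n k hab)]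
  exact sum_le_sum_of_subset_of_nonneg (subset_univ _) fun j _ _ => hh j

omit hM in
/-- `|{0,1,2}^d| = 3^d`. [folklore] -/
theorem card_offsets : (Finset.univ : Finset (Fin d → Fin 3)).card = 3 ^ d := by
  rw [Finset.card_univ, Fintype.card_fun, Fintype.card_fin, Fintype.card_fin]

/-! ## §2 The bond sums per sub-block -/

/-- the in-block `ρ`-bonds of `w` in the digit chart: `j_ρ + 1 < n`. [folklore] -/
abbrev Tin (ρ : Fin d) : Finset (Fin d → Fin n) := univ.filter fun j : Fin d → Fin n => (j ρ : ℕ) + 1 < n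

/-- the in-block gradient sum of `g` on `w` in direction `ρ`. [folklore] -/
abbrev gradSum (g : Tor (fine n M) → ℂ) (ρ : Fin d) : ℝ :=
  ∑ j ∈ Tin n ρ, ‖(sdiff (fine n M) (n : ℂ) ρ *ᵥ g) (bpt n M w j)‖ ^ 2

omit [NeZero n] in
/-- digit predecessor in direction `ρ` (junk-free on `j_ρ ≥ 1`). [folklore] -/
def predD (ρ : Fin d) (j : Fin d → Fin n) : Fin d → Fin n :=
  Function.update j ρ ⟨(j ρ : ℕ) - 1, lt_of_le_of_lt (Nat.sub_le _ _) (j ρ).isLt⟩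

/-- **IDENTITY DIRECTION** (`k_ρ = 1`): the bond terms of sub-block `k` are at most the in-block gradient sum. [folklore] -/
theorem sum_Dterm_le_of_eq (hM3 : ∀ μ, 3 ≤ M μ) (g : Tor (fine n M) → ℂ) (k : Fin d → Fin 3) (ρ : Fin d) (hk : (k ρ : ℕ) = 1) :
    ∑ j, Dterm n M w g k j ρ ≤ gradSum n M w g ρ := by
  classical
  -- only in-block steps contribute
  have hsplit : ∑ j, Dterm n M w g k j ρ
      = ∑ j ∈ Tin n ρ, ‖(sdiff (fine n M) (n : ℂ) ρ *ᵥ g) (bpt n M w (foldD n k j))‖ ^ 2 := by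
    rw [← Finset.sum_filter_add_sum_filter_not univ (fun j : Fin d → Fin n => (j ρ : ℕ) + 1 < n)]
    have h0 : ∑ j ∈ univ.filter (fun j : Fin d → Fin n => ¬ ((j ρ : ℕ) + 1 < n)), Dterm n M w g k j ρ = 0 :=
      sum_eq_zero fun j hj => by rw [Dterm, if_neg (mem_filter.1 hj).2]
    rw [h0, add_zero]
    refine sum_congr rfl fun j hj => ?_
    have hlt := (mem_filter.1 hj).2
    rw [Dterm, if_pos hlt, fold_step_id n M w hM3 k j ρ hlt hk, fold_csite n M w hM3, sdiff_mulVec, norm_mul,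
      Complex.norm_natCast, mul_pow]
  rw [hsplit, gradSum]
  -- reindex by the fold (injective, stays in `Tin`)
  rw [← Finset.sum_image (f := fun j => ‖(sdiff (fine n M) (n : ℂ) ρ *ᵥ g) (bpt n M w j)‖ ^ 2)
    (fun a _ b _ hab => foldD_injective n k hab)]
  refine sum_le_sum_of_subset_of_nonneg (fun j' hj' => ?_) fun _ _ _ => by positivity
  obtain ⟨j, hj, rfl⟩ := mem_image.1 hj'
  have hlt := (mem_filter.1 hj).2
  exact mem_filter.2 ⟨mem_univ _, by simp only [foldD, hk, if_true]; exact hlt⟩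

/-- **REFLECTED DIRECTION** (`k_ρ ≠ 1`): the bond terms of sub-block `k` are at most the in-block gradient sum (each in-block bond of `w`
is read reversed, once). [folklore] -/
theorem sum_Dterm_le_of_ne (hM3 : ∀ μ, 3 ≤ M μ) (g : Tor (fine n M) → ℂ) (k : Fin d → Fin 3) (ρ : Fin d) (hk : (k ρ : ℕ) ≠ 1) :
    ∑ j, Dterm n M w g k j ρ ≤ gradSum n M w g ρ := by
  classical
  set G : (Fin d → Fin n) → ℝ := fun j => ‖(sdiff (fine n M) (n : ℂ) ρ *ᵥ g) (bpt n M w j)‖ ^ 2 with hG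
  set H : (Fin d → Fin n) → ℝ := fun j' => G (predD n ρ j') with hH
  -- (1) only in-block steps contribute, and each reads the reversed bond below the folded site
  have hsplit : ∑ j, Dterm n M w g k j ρ = ∑ j ∈ Tin n ρ, H (foldD n k j) := by
    rw [← Finset.sum_filter_add_sum_filter_not univ (fun j : Fin d → Fin n => (j ρ : ℕ) + 1 < n)]
    have h0 : ∑ j ∈ univ.filter (fun j : Fin d → Fin n => ¬ ((j ρ : ℕ) + 1 < n)), Dterm n M w g k j ρ = 0 :=
      sum_eq_zero fun j hj => by rw [Dterm, if_neg (mem_filter.1 hj).2]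
    rw [h0, add_zero]
    refine sum_congr rfl fun j hj => ?_
    have hlt := (mem_filter.1 hj).2
    -- the folded image of `x + e_ρ`
    have hy' : fold n M w (csite n M w k j + unitVec (fine n M) ρ) = bpt n M w (predD n ρ (foldD n k j)) := by
      rw [csite_add_unitVec_of_lt n M w k j ρ hlt, fold_csite n M w hM3]
      congr 1
      funext μ
      simp only [foldD, predD, Function.update_apply]
      by_cases hμ : μ = ρ
      · subst hμ; simp only [if_true, if_neg hk]; apply Fin.ext; simp only [Fin.val_rev]; omega
      · simp only [if_neg hμ]
    have hstep := fold_step_rev n M w hM3 k j ρ hlt hk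
    rw [Dterm, if_pos hlt, hH, hG]
    simp only
    rw [← hy', hstep, norm_sub_rev, sdiff_mulVec, norm_mul, Complex.norm_natCast, mul_pow]
  rw [hsplit]
  -- (2) reindex by the fold: lands in `T' = {1 ≤ j'_ρ}`
  have h2 : ∑ j ∈ Tin n ρ, H (foldD n k j) ≤ ∑ j' ∈ univ.filter (fun j' : Fin d → Fin n => 1 ≤ (j' ρ : ℕ)), H j' := by
    rw [← Finset.sum_image (f := H) (fun a _ b _ hab => foldD_injective n k hab)]
    refine sum_le_sum_of_subset_of_nonneg (fun j' hj' => ?_) fun _ _ _ => by positivity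
    obtain ⟨j, hj, rfl⟩ := mem_image.1 hj'
    have hlt := (mem_filter.1 hj).2
    refine mem_filter.2 ⟨mem_univ _, ?_⟩
    simp only [foldD, if_neg hk, Fin.val_rev]
    omega
  -- (3) reindex by the predecessor: lands in `Tin`
  have h3 : ∑ j' ∈ univ.filter (fun j' : Fin d → Fin n => 1 ≤ (j' ρ : ℕ)), H j' ≤ gradSum n M w g ρ := by
    have hinj : Set.InjOn (predD n ρ) ↑(univ.filter (fun j' : Fin d → Fin n => 1 ≤ (j' ρ : ℕ))) := by
      intro a ha b hb hab
      have ha1 : 1 ≤ (a ρ : ℕ) := (mem_filter.1 ha).2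
      have hb1 : 1 ≤ (b ρ : ℕ) := (mem_filter.1 hb).2
      funext μ
      have hμ := congrFun hab μ
      by_cases hμρ : μ = ρ
      · subst hμρ
        simp only [predD, Function.update_self, Fin.mk.injEq] at hμ
        apply Fin.ext; omega
      · simpa only [predD, Function.update_of_ne hμρ] using hμ
    rw [hH, ← Finset.sum_image (f := G) hinj, gradSum]
    refine sum_le_sum_of_subset_of_nonneg (fun j'' hj'' => ?_) fun _ _ _ => by positivity
    obtain ⟨j', hj', rfl⟩ := mem_image.1 hj''
    have h1 : 1 ≤ (j' ρ : ℕ) := (mem_filter.1 hj').2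
    refine mem_filter.2 ⟨mem_univ _, ?_⟩
    simp only [predD, Function.update_self]
    have := (j' ρ).isLt
    omega
  exact h2.trans h3

/-- both cases. [folklore] -/
theorem sum_Dterm_le (hM3 : ∀ μ, 3 ≤ M μ) (g : Tor (fine n M) → ℂ) (k : Fin d → Fin 3) (ρ : Fin d) :
    ∑ j, Dterm n M w g k j ρ ≤ gradSum n M w g ρ := by
  by_cases hk : (k ρ : ℕ) = 1
  · exact sum_Dterm_le_of_eq n M w hM3 g k ρ hk
  · exact sum_Dterm_le_of_ne n M w hM3 g k ρ hk

/-! ## §3 The gradient of the lift -/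

/-- **THE GRADIENT OF THE COLLAR LIFT IS PAID BY THE BLOCK DATA OF `g`** (`3 ≤ M_ν`):
`nsq (∂ (lift g)) ≤ 2·3^d·Σ_ρ gradSum_ρ + 2d·3^d·Σ_j ‖g (bpt w j)‖²`. [folklore] -/
theorem nsq_grad_lift_le (hM3 : ∀ μ, 3 ≤ M μ) (g : Tor (fine n M) → ℂ) :
    nsq (GradOp (fine n M) (n : ℂ) *ᵥ lift n M w g)
      ≤ 2 * 3 ^ d * ∑ ρ : Fin d, gradSum n M w g ρ + 2 * d * 3 ^ d * ∑ j : Fin d → Fin n, ‖g (bpt n M w j)‖ ^ 2 := by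
  classical
  -- the bond sum as a site sum of `Φ x = Σ_ρ n²‖lift(x+e_ρ) − lift x‖²`
  set Φ : Tor (fine n M) → ℝ := fun x => ∑ ρ : Fin d, (n : ℝ) ^ 2 * ‖lift n M w g (x + unitVec (fine n M) ρ) - lift n M w g x‖ ^ 2
    with hΦ
  have hnsq : nsq (GradOp (fine n M) (n : ℂ) *ᵥ lift n M w g) = ∑ x, Φ x := by
    unfold nsq
    rw [Fintype.sum_prod_type]
    refine sum_congr rfl fun x _ => sum_congr rfl fun ρ _ => ?_
    rw [GradOp_mulVec, sdiff_mulVec, norm_mul, Complex.norm_natCast, mul_pow]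
  have hΦ0 : ∀ x, x ∉ collar n M w → Φ x = 0 := fun x hx =>
    sum_eq_zero fun ρ _ => by rw [lift_step_of_not_mem n M w hM3 g hx ρ, norm_zero]; simp
  rw [hnsq, sum_collar_eq n M w hM3 Φ hΦ0]
  -- bond by bond at the collar sites
  have hpt : ∀ k j, Φ (csite n M w k j) ≤ ∑ ρ, (2 * Dterm n M w g k j ρ + 2 * ‖g (bpt n M w (foldD n k j))‖ ^ 2) := by
    intro k j
    refine sum_le_sum fun ρ _ => ?_
    have h := lift_step_sq_le n M w hM3 g k j ρ
    rw [fold_csite n M w hM3] at h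
    exact h
  have hk : ∀ k : Fin d → Fin 3,
      ∑ j, Φ (csite n M w k j) ≤ 2 * ∑ ρ, gradSum n M w g ρ + 2 * d * ∑ j : Fin d → Fin n, ‖g (bpt n M w j)‖ ^ 2 := by
    intro k
    calc ∑ j, Φ (csite n M w k j)
        ≤ ∑ j, ∑ ρ, (2 * Dterm n M w g k j ρ + 2 * ‖g (bpt n M w (foldD n k j))‖ ^ 2) := sum_le_sum fun j _ => hpt k j
      _ = 2 * ∑ ρ, ∑ j, Dterm n M w g k j ρ + 2 * (d * ∑ j, ‖g (bpt n M w (foldD n k j))‖ ^ 2) := by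
          rw [sum_comm]
          simp only [sum_add_distrib, ← mul_sum, sum_const, card_univ, Fintype.card_fin, nsmul_eq_mul]
      _ ≤ 2 * ∑ ρ, gradSum n M w g ρ + 2 * (d * ∑ j : Fin d → Fin n, ‖g (bpt n M w j)‖ ^ 2) :=
          add_le_add (mul_le_mul_of_nonneg_left (sum_le_sum fun ρ _ => sum_Dterm_le n M w hM3 g k ρ) (by norm_num))
            (mul_le_mul_of_nonneg_left (mul_le_mul_of_nonneg_left
              (sum_foldD_le n k (fun j => ‖g (bpt n M w j)‖ ^ 2) fun j => by positivity) (by positivity)) (by norm_num))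
      _ = _ := by ring
  calc ∑ k : Fin d → Fin 3, ∑ j : Fin d → Fin n, Φ (csite n M w k j)
      ≤ ∑ _k : Fin d → Fin 3, (2 * ∑ ρ, gradSum n M w g ρ + 2 * d * ∑ j : Fin d → Fin n, ‖g (bpt n M w j)‖ ^ 2) :=
        sum_le_sum fun k _ => hk k
    _ = 2 * 3 ^ d * ∑ ρ, gradSum n M w g ρ + 2 * d * 3 ^ d * ∑ j : Fin d → Fin n, ‖g (bpt n M w j)‖ ^ 2 := by
        rw [sum_const, card_offsets, nsmul_eq_mul]; push_cast; ring

end Summit.QuantumFields.BalabanUV.T4Continuum.RegionCollarLift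

end
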